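import Mathlib
import HarnessLib
import Summits.FinalStateConjecture.FinalStateConjecture.Statement

/-!
# Crux `RecurrentlyFlatDisperses` (stmt-FinalStateConjecture-14665), line `Sketch`
# (card `outgoing-blind-cup-restart`) — registered stub `stub_settlesOfScriCapture` (skeleton v6)

PACKAGING, sharpened form (continuation lead c1, 2026-08-16). Skeleton v6 weakens the research core
`stub_capture` so that its `𝓘⁺` conjunct is EXACTLY what the crux consumes: the sojourn-form completeness
of future null infinity of the development, `Summit.FinalStateConjecture.HasCompleteNullInfinity 𝒟`, instead of
the strictly stronger "every normalised null ray from the data hypersurface is future complete" of v1–v5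
(`stub_settlesOfCapture`, landed). This file is the matching packaging stub: SCRI-CAPTURE DATA — complete `𝓘⁺`
(sojourn form) and a convergent anchored flat late chart `Φ : U₁ → 𝒟`, `{x⁰ > τ₁} ⊆ U₁`, which is a late
chart into its self-determined exterior `O₁ = J⁺(Σ) ∩ I⁻(Φ{x⁰ > τ₁})` with `deviationCk … 2 τ → 0` and the
covering/exhaustion clause for every `τ ≥ τ₁` — give the Statement's conclusion: complete `𝓘⁺` (verbatim) and
the `N = 0` `FinalStateDecomposition 𝒟.toSpacetime O₁ 2` (flat domain `U₁`, flat chart `Φ`, no holes) with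
`O₁ = exteriorOf d.charted` (`d.charted = Φ '' lateRegion τ₁ ∪ ⋃ over Fin 0`) and `HasExhaustiveCharts d`
(radii `Fin 0 → _`; `certifiedLate`/`certifiedSlab` reduce to the flat pieces). The decomposition half is the
argument of the landed `stub_settlesOfCapture` (p116462), repeated here because that theorem's hypothesis is the
strong ray form. Mathlib + the Statement cone only; no definitions, no named facts.
-/

noncomputable section

open scoped Manifold ContDiff Topology
open Filter Set TopologicalSpace Literature.Geometry.Lorentzian

namespace Summit.FinalStateConjecture.FinalStateConjecture.Theorems.RecurrentlyFlatDisperses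

/-- **Scri-capture data settle the development** (registered stub `stub_settlesOfScriCapture` of crux
stmt-FinalStateConjecture-14665, skeleton v6: `ScriCaptureData 𝒟 → Settles 𝒟` unfolded): complete `𝓘⁺`
in the sojourn form together with a convergent (`C²`) anchored flat late chart on a late half-space, which
is a late chart into its self-determined exterior and exhausts it at every later chart time, give complete
`𝓘⁺` and an exhaustive `N = 0` final-state decomposition of that exterior. -/
theorem stub_settlesOfScriCapture :
    ∀ (X : Type) [TopologicalSpace X] [ChartedSpace E3 X] [IsManifold (𝓡 3) ∞ X] [T2Space X]
      [SecondCountableTopology X] [ConnectedSpace X] (D : InitialDataSet (𝓡 3) X)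
      (𝒟 : VacuumCauchyDevelopment D),
        (Summit.FinalStateConjecture.HasCompleteNullInfinity 𝒟.toCauchyDevelopment ∧
          ∃ (τ₁ : ℝ) (U₁ : Opens E4) (Φ : U₁ → 𝒟.carrier),
            {x : E4 | τ₁ < x 0} ⊆ (U₁ : Set E4) ∧
            𝒟.toSpacetime.IsLateChart (Minkowski.backgroundOn U₁)
              (Summit.FinalStateConjecture.exteriorOf 𝒟.toCauchyDevelopment
                (Φ '' (Minkowski.backgroundOn U₁).lateRegion τ₁)) τ₁ Φ ∧
            Tendsto (fun τ ↦ 𝒟.toSpacetime.deviationCk (Minkowski.backgroundOn U₁) Φ 2 τ)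
              atTop (𝓝 0) ∧
            (∀ τ : ℝ, τ₁ ≤ τ →
              Summit.FinalStateConjecture.exteriorOf 𝒟.toCauchyDevelopment
                  (Φ '' (Minkowski.backgroundOn U₁).lateRegion τ₁) \
                    Φ '' (Minkowski.backgroundOn U₁).lateRegion τ ⊆
                𝒟.metric.causalPast 𝒟.timeOrientation
                  (Φ '' (Minkowski.backgroundOn U₁).timeSlab τ))) →
        (Summit.FinalStateConjecture.HasCompleteNullInfinity 𝒟.toCauchyDevelopment ∧
          ∃ (O : Set 𝒟.carrier) (d : FinalStateDecomposition 𝒟.toSpacetime O 2),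
            (∀ i, Kerr.IsSubextremal (d.mass i) (d.spin i)) ∧
              O = Summit.FinalStateConjecture.exteriorOf 𝒟.toCauchyDevelopment d.charted ∧
                Summit.FinalStateConjecture.HasExhaustiveCharts d) := by
  intro X _ _ _ _ _ _ D 𝒟 h
  obtain ⟨hscri, τ₁, U₁, Φ, hU, hlate, hdev, hexh⟩ := h
  refine ⟨hscri, ?_⟩
  -- the `N = 0` decomposition of the self-determined exterior of the flat chart
  let O' : Set 𝒟.carrier := Summit.FinalStateConjecture.exteriorOf 𝒟.toCauchyDevelopment
    (Φ '' (Minkowski.backgroundOn U₁).lateRegion τ₁)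
  let d : FinalStateDecomposition 𝒟.toSpacetime O' 2 :=
    { N := 0
      mass := Fin.elim0
      spin := Fin.elim0
      mass_pos := fun i ↦ i.elim0
      abs_spin_le_mass := fun i ↦ i.elim0
      motion := Fin.elim0
      τ₀ := τ₁
      chart := fun i ↦ i.elim0
      isLateChart := fun i ↦ i.elim0
      tendsto_truncDeviationCk := fun i ↦ i.elim0
      exists_pairwise_disjoint := fun _ ↦ ⟨0, fun i ↦ i.elim0⟩
      excision := Fin.elim0
      tendsto_excision_div := fun i ↦ i.elim0
      flatDomain := U₁
      setOf_lt_excision_subset_flatDomain := fun x hx ↦ hU hx.1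
      flatChart := Φ
      isLateChart_flat := hlate
      tendsto_deviationCk_flat := hdev
      diff_subset_causalPast := by
        intro p hp
        have hp2 : p ∉ Φ '' (Minkowski.backgroundOn U₁).lateRegion τ₁ :=
          fun h' ↦ hp.2 (Or.inr h')
        have hJ := hexh τ₁ le_rfl ⟨hp.1, hp2⟩
        exact LorentzianMetric.causalFuture_mono subset_union_right hJ }
  -- `HasExhaustiveCharts` re-typed (Statement audit T2, 2026-08-16: honest radii clause); for
  -- `N = 0` every clause over `Fin 0` is vacuous (repair, continuation lead c5)
  refine ⟨O', d, fun i ↦ i.elim0, ?_,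
    ⟨fun i ↦ i.elim0, fun i ↦ i.elim0, fun i ↦ i.elim0, fun τ hτ ↦ ?_⟩⟩
  · -- `O' = J⁺(ι X) ∩ I⁻(d.charted)`, as `d.charted = Φ '' {x⁰ > τ₁} ∪ ⋃ (over Fin 0)`
    have hch : d.charted = Φ '' (Minkowski.backgroundOn U₁).lateRegion τ₁ := by
      ext p
      simp only [FinalStateDecomposition.charted, Set.mem_union, Set.mem_iUnion]
      constructor
      · rintro (h' | ⟨i, -⟩)
        · exact h'
        · exact i.elim0
      · exact fun h' ↦ Or.inl h'
    rw [hch]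
  · -- exhaustion at chart time `τ > τ₁`: the certified pieces are the flat ones
    intro p hp
    have hp2 : p ∉ Φ '' (Minkowski.backgroundOn U₁).lateRegion τ := fun h' ↦ hp.2 (Or.inl h')
    have hJ := hexh τ (le_of_lt hτ) ⟨hp.1, hp2⟩
    exact LorentzianMetric.causalFuture_mono subset_union_left hJ

end Summit.FinalStateConjecture.FinalStateConjecture.Theorems.RecurrentlyFlatDisperses

end
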